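import Summits.BirchSwinnertonDyer.BirchSwinnertonDyer.Theses.CyclotomicUntwist
import Summits.BirchSwinnertonDyer.BirchSwinnertonDyer.Theorems.CyclotomicUntwistFiniteSlopeSeparatedPinnedLogNorm
import Summits.BirchSwinnertonDyer.BirchSwinnertonDyer.Theorems.CyclotomicUntwistLineCoefficients
import Summits.BirchSwinnertonDyer.BirchSwinnertonDyer.Theorems.CyclotomicUntwistPSUntwistedTraceDefs
import Summits.BirchSwinnertonDyer.BirchSwinnertonDyer.Theorems.CyclotomicUntwistDescendedFrobeniusEigenconstantCoeffs
import Literature.NumberTheory.EllipticCurves.DescendedFrobeniusMatrix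
import HarnessLib

/-!
# K-SEP glue of route `CyclotomicUntwist`: the children of K1 `PSRankOneLowerHalfAtThree` give BOTH halves
# (glue item stmt-BirchSwinnertonDyer-27550 `PSLowerHalfOfDFrobChildren`; K2 `PSRankOneUpperHalfAtThree` directly)

Cell `pub/bsd-wall`, pen bsd-wall-pss3x g5 — TURNKEY closer (a prover lands it verbatim as
`Theorems/CyclotomicUntwistKSepGlue.lean --workitem stmt-BirchSwinnertonDyer-27550`). The split (route rev 5,
commit 098898f6e607) filed the registered stubs of line `dfrob` (lead bsd-line-cycu-p1 g5, `Cruxes/PSRankOneLowerHalfAtThree/Lines/dfrob.lean`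
sha16 7b2ff71c50f8108a) VERBATIM as the children C4 = `PSGrossZagierDescendedEigenlineAtThree` (27546, N-GZ₃′),
C5 = `PSpAdicBSDDescendedEigenlineAtThree` (27547, pBSD₃′), C1 = `PSUntwistedLFunctionAtThree` (27548, EX′),
C2 = `PSDescendedFrobeniusPrintedInputsAtThree` (27549, PUB ∧ descended Frobenius matrix); S3 is the landed
`eigenconstant_coeffs` (p625113). The proof below is the skeleton's sorry-free composition with the stubs replaced by
the children. THEOREMS ONLY; BSD is not proved here and no child is.
-/

set_option linter.dupNamespace false
noncomputable section

open scoped Classical MatrixGroups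
open CongruenceSubgroup WeierstrassCurve WeierstrassCurve.Affine.Point Literature.NumberTheory.EllipticCurves
  Literature.NumberTheory.EllipticCurves.ModularForms Literature.NumberTheory.EllipticCurves.Rank1Residual
  Literature.NumberTheory.IwasawaTheory Summit.BirchSwinnertonDyer.Rank1Residual.Additive
  Summit.BirchSwinnertonDyer.BirchSwinnertonDyer.Theses.CyclotomicUntwist
  Summit.BirchSwinnertonDyer.BirchSwinnertonDyer.Theorems.CyclotomicUntwistFiniteSlopeSeparatedPinnedLogNorm
  Summit.BirchSwinnertonDyer.BirchSwinnertonDyer.Theorems.PSLineCoefficients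
  IsCyclotomicExtension

namespace Summit.BirchSwinnertonDyer.BirchSwinnertonDyer.Theorems.CyclotomicUntwistKSepGlue

/-- `((n : ℤ) : ℂ₃) = algebraMap ℚ₃ ℂ₃ ((n : ℤ) : ℚ₃)` (cast bookkeeping). -/
theorem intCast_eq_algebraMap_three (n : ℤ) : ((n : ℤ) : ℂ_[3]) = algebraMap ℚ_[3] ℂ_[3] (n : ℚ_[3]) := by
  rw [map_intCast]

/-- BOTH HALVES from the four children of the K-SEP split (composition of line `dfrob`, stubs ↦ hypotheses). -/
theorem psRankOne_halves_of_dfrobChildren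
    (h4 : PSGrossZagierDescendedEigenlineAtThree) (h5 : PSpAdicBSDDescendedEigenlineAtThree)
    (h1 : PSUntwistedLFunctionAtThree) (h2 : PSDescendedFrobeniusPrintedInputsAtThree) :
    PSRankOneLowerHalfAtThree ∧ PSRankOneUpperHalfAtThree := by
  -- the coefficient package
  obtain ⟨ψ, σ, hψ2, hψ3, hψ1, hσ⟩ := exists_line_and_conjugation
  obtain ⟨ι, hι⟩ := exists_algHom_padicComplex_injective
  -- the eigenline dictionary as a predicate on pairs `(a, b)`
  let Good : (W : WeierstrassCurve ℚ) → ℂ_[3] → ℚ_[3] × ℚ_[3] → Prop := fun W α ab =>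
    ab.2 ≠ 0 ∧ ∀ M : Matrix (Fin 2) (Fin 2) ℚ_[3], W.IsDescendedFrobeniusMatrix M →
      (algebraMap ℚ_[3] ℂ_[3] ab.1 + algebraMap ℚ_[3] ℂ_[3] ab.2 * ι (ψ 2)) * algebraMap ℚ_[3] ℂ_[3] (M 1 0) =
        algebraMap ℚ_[3] ℂ_[3] (M 0 0) + (α - algebraMap ℚ_[3] ℂ_[3] M.trace)
  -- the D5 numbers by choice (junk `(0, 1)` off the locus where the dictionary applies)
  let ab : (W : WeierstrassCurve ℚ) → DirichletCharacter ℂ_[3] (3 ^ 2) → ℂ_[3] → ℚ_[3] × ℚ_[3] :=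
    fun W _ α => if h : ∃ p : ℚ_[3] × ℚ_[3], Good W α p then h.choose else (0, 1)
  have hb : ∀ W η α, (ab W η α).2 ≠ 0 := by
    intro W η α
    show (if h : ∃ p : ℚ_[3] × ℚ_[3], Good W α p then h.choose else ((0 : ℚ_[3]), (1 : ℚ_[3]))).2 ≠ 0
    split_ifs with h
    · exact h.choose_spec.1
    · exact one_ne_zero
  have hgood : ∀ W η α, (∃ p : ℚ_[3] × ℚ_[3], Good W α p) → Good W α (ab W η α) := by
    intro W η α h
    show Good W α (if h : ∃ p : ℚ_[3] × ℚ_[3], Good W α p then h.choose else ((0 : ℚ_[3]), (1 : ℚ_[3])))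
    rw [dif_pos h]
    exact h.choose_spec
  -- on a principal-series row the dictionary applies at the admissible root `α`
  have hrow : ∀ (W : WeierstrassCurve ℚ) [W.IsElliptic] [W.IsGloballyMinimal],
      Summit.BirchSwinnertonDyer.Rank1Residual.Additive.ClassO6 W 3 →
      Even (padicValInt 3 W.minimalDiscriminantInt) →
      W.minimalDiscriminantInt / 3 ^ padicValInt 3 W.minimalDiscriminantInt % 3 = 1 →
      ∀ (η : DirichletCharacter ℂ_[3] (3 ^ 2)) (α : ℂ_[3]),
        α ^ 2 - ((W.psUntwistedTrace : ℤ) : ℂ_[3]) * α + 3 = 0 →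
        ∃ M : Matrix (Fin 2) (Fin 2) ℚ_[3], W.IsDescendedFrobeniusMatrix M ∧ Good W α (ab W η α) := by
    intro W _ _ hO6 hev hsq η α hroot
    obtain ⟨M, hM, htr, hγ⟩ := h2.2 W hO6 hev hsq
    have htr' : M.trace = 0 ∨ M.trace = 3 ∨ M.trace = -3 := by
      rcases Summit.BirchSwinnertonDyer.BirchSwinnertonDyer.Theorems.PSUntwistedTrace.psUntwistedTrace_eq_or W
        with h | h | h
      · exact Or.inl (by rw [htr, h]; push_cast; rfl)
      · exact Or.inr (Or.inl (by rw [htr, h]; push_cast; rfl))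
      · exact Or.inr (Or.inr (by rw [htr, h]; push_cast; rfl))
    have hroot' : α ^ 2 - algebraMap ℚ_[3] ℂ_[3] M.trace * α + 3 = 0 := by
      rw [htr, ← intCast_eq_algebraMap_three]; exact hroot
    obtain ⟨a, b, hb0, hdict⟩ :=
      Summit.BirchSwinnertonDyer.BirchSwinnertonDyer.Theorems.PSDescendedFrobeniusEigenconstantCoeffs.eigenconstant_coeffs
        ψ ι hψ2 hι M α hM.det_eq htr' hγ hroot'
    refine ⟨M, hM, hgood W η α ⟨(a, b), hb0, fun M' hM' => ?_⟩⟩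
    rw [hM'.unique hM]
    exact hdict
  -- the closer of record
  have H := psRankOne_halves_of_separated_pin_intrinsic_sigmaLine_log_norm (R := CyclotomicField 3 ℚ_[3])
    ι hι ψ σ hσ ⟨hψ3, hψ1⟩ (fun _ _ _ => (0 : ℚ_[3])) (fun W η α => (ab W η α).1) (fun W η α => (ab W η α).2)
    (fun _ _ _ => by rw [norm_zero]; exact zero_le_one) hb
    (fun W η α Dh => ∀ χ : DirichletCharacter (CyclotomicField 3 ℚ_[3]) 9, (χ = ψ ∨ χ = ψ⁻¹) →
      ∀ {x y : ℚ} (hxy : W.toAffine.Nonsingular x y),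
        1 < ‖(x : ℚ_[3])‖ → ‖(-(x : ℚ_[3]) / (y : ℚ_[3]))‖ ≤ ((3 : ℝ)⁻¹) ^ 3 →
          (∀ ℓ : ℕ, ℓ.Prime → W.HasNonsingularReductionAt ℓ x y) →
            Dh.pairing χ (.some x y hxy) (.some x y hxy) =
              algebraMap ℚ_[3] (CyclotomicField 3 ℚ_[3]) (CensusX42.sigmaHeight W 3
                  ((W.baseChange ℚ_[3]).formalSigma 0) (.some x y hxy)) +
                (algebraMap ℚ_[3] (CyclotomicField 3 ℚ_[3]) (ab W η α).1 +
                    algebraMap ℚ_[3] (CyclotomicField 3 ℚ_[3]) (ab W η α).2 * χ 2) *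
                  algebraMap ℚ_[3] (CyclotomicField 3 ℚ_[3])
                    (padicEval (W.baseChange ℚ_[3]).formalLog (-(x : ℚ_[3]) / (y : ℚ_[3]))) ^ 2)
    (fun W _ _ η α Dh => by simp only [_root_.map_zero, sub_zero])
    (fun W => W.psUntwistedTrace) h2.1 h1 ?_ ?_
  · exact H
  · -- N-GZ₃′ from S4 at THE matrix and the chosen numbers
    intro W _ _ hCM hO6 hsurj hev hsq hr η α 𝓛 ϖ hη hroot hμ hϖ Dh hDh P hP q hL
    obtain ⟨M, hM, hb0, hdict⟩ := hrow W hO6 hev hsq η α hroot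
    exact h4 ψ ι hψ2 hι W hCM hO6 hsurj hev hsq hr η α 𝓛 ϖ hη hroot hμ hϖ M hM
      (ab W η α).1 (ab W η α).2 hb0 (hdict M hM) Dh hDh P hP q hL
  · -- pBSD₃′ from S5
    intro W _ _ hCM hO6 hsurj hev hsq hr η α 𝓛 ϖ hη hroot hμ hϖ Dh hDh P hP
    obtain ⟨M, hM, hb0, hdict⟩ := hrow W hO6 hev hsq η α hroot
    exact h5 ψ ι hψ2 hι W hCM hO6 hsurj hev hsq hr η α 𝓛 ϖ hη hroot hμ hϖ M hM
      (ab W η α).1 (ab W η α).2 hb0 (hdict M hM) Dh hDh P hP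


/-- CLOSER of the glue item stmt-BirchSwinnertonDyer-27550 `PSLowerHalfOfDFrobChildren : C4 → C5 → C1 → C2 → K1`. -/
theorem psLowerHalfOfDFrobChildren_proof : PSLowerHalfOfDFrobChildren :=
  fun h4 h5 h1 h2 => (psRankOne_halves_of_dfrobChildren h4 h5 h1 h2).1

/-- K2 `PSRankOneUpperHalfAtThree` (item 21581) from the same four children — its direct closer once they are theorems. -/
theorem psRankOneUpperHalfAtThree_of_dfrobChildren :
    PSGrossZagierDescendedEigenlineAtThree → PSpAdicBSDDescendedEigenlineAtThree →
      PSUntwistedLFunctionAtThree → PSDescendedFrobeniusPrintedInputsAtThree → PSRankOneUpperHalfAtThree :=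
  fun h4 h5 h1 h2 => (psRankOne_halves_of_dfrobChildren h4 h5 h1 h2).2

end Summit.BirchSwinnertonDyer.BirchSwinnertonDyer.Theorems.CyclotomicUntwistKSepGlue
end
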